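/-
Origin: expansion seat `planner-pub-hodgecm-pv11-0`, handover 2026-08-18T03:53:51Z (`HOME/pub-hodgecm-pv11/lean/Pv11/SeesawWedge.lean`, md5 f76ae82c, 179 lines);
landed by the gen-5 packager in gate run 20 as `HodgeCM/PerL34/SeesawWedge.lean` (verbatim).
-/
/-
Copyright: pub-hodgecm cell, 2026-08-18.  Seat pv11 (planner-pub-hodgecm-pv11-0), DAG node N17 addendum — the USE of
Lemma 3.4 inside the proof of Lemma 3.5 (node N19, residual input (1) of GAPS.md `pv08/N19`).
-/
import Summits.HodgeConjecture.HodgeCM.PerL34.Seesaw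

/-!
# The seesaw-generator identity at the level of the theta data (PerL v5 tex ll. 372–375)

GAPS.md `pv08/N19` records as residual INPUT (1) of Lemma 3.5 (i) the *seesaw-generator identity*, typed over the
opaque interface as `HodgeCM.PerL34.S12Wedges.N19w_genIdentity`, with the diagnosis "the package has NO
Weil-representation / theta-kernel vocabulary (LEMMAS.md §3 D4) … so the identity cannot even be unfolded … with
[D4] (1) becomes a computation".  The landed `HodgeCM.PerL34.Seesaw` (node N17) IS that vocabulary for a plane
`W = W₁ ⊕ W₂` (`ThetaSeesawData`: theta kernels as lattice sums, theta lifts and torus periods as integrals, and the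
kernel-proved (eq:seesaw)).  This file performs the computation.

VERBATIM, PerL v5:
* l. 246–247 (§3.1): "a holomorphic `1`-form `u ∈ (π⊗τ)^{K_∞}`, `π ∈ 𝒜^{1,0}`, is a pair `(u¹,u²)` of `K_∞`-finite
  scalar functions in the lowest `K_{ι₁}`-type `𝔭₊ ⊂ π` (and `U(3)`-invariant at `b ≠ ι₁`), and `u₁∧u₂` is the scalar
  function `u₁¹u₂² − u₁²u₂¹`."
* ll. 372–375 (proof of Lemma 3.5): "conversely every such wedge is a generator (`u^i_j = θ(φ^i_j,χ′_j)` with `φ^i_j`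
  of type `𝔭₊`, and `u₁∧u₂ = ϑ_{T,χ₁₂}(Φ′) = pr_κ ϑ_{T,χ₁₂}(Φ′) = ϑ_{T,χ₁₂}(pr_κ Φ′)` for
  `Φ′ = φ¹₁⊗φ²₂ − φ²₁⊗φ¹₂`, since `u₁∧u₂` is of pure type `κ` and `pr_κ` commutes with `ϑ_{T,χ₁₂}`)."

WHAT IS KERNEL-PROVED HERE (over the posited data `D : ThetaSeesawData`, with `D.S` an additive group):
* `thetaKernel_sub`, `thetaPeriod_sub` — `Φ ↦ θ_Φ` and `Φ ↦ ϑ_{T,χ₁₂}(Φ)` respect differences (from the two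
  STRUCTURAL hypotheses `OmegaSub`, `EvSub` below = "`ω(g,t)` and evaluation at a rational point are additive",
  i.e. `ω_{W,μ_W}` is a (linear) representation on the vector space `𝒮((V₃⊗W)(𝔸))`, PerL l. 261);
* `summable_ev_tmul`, `thetaKernel_wedge` — the theta kernel of `Φ′` is
  `θ_{φ¹₁}(g,u₁)θ_{φ²₂}(g,u₂) − θ_{φ²₁}(g,u₁)θ_{φ¹₂}(g,u₂)`;
* **`genIdentity_core`** — the first equality of ll. 374–375:
  `u₁∧u₂ := u₁¹u₂² − u₁²u₂¹ = ϑ_{T,χ₁₂}(Φ′)`, `u^i_j = θ(φ^i_j,χ′_j)`, `Φ′ = φ¹₁⊗φ²₂ − φ²₁⊗φ¹₂`,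
  from (eq:seesaw) (`eq_seesaw`, node N17) twice and additivity; the regularity used is integrability of the four
  functions `u ↦ θ_{φ^i_j}(g,u)χ′_j(u)` on `[U(W_j)]` (PerL l. 335: "all integrals over compact sets of continuous
  functions"), carried as hypotheses `hI…`.
WHAT IS NOT TOUCHED: the remaining two equalities of l. 374 (`pr_κ` commutes with `ϑ_{T,χ₁₂}`; `u₁∧u₂` is of pure
type `κ`) — they need the `K_∞`-action (LEMMAS.md §3 D5) — and the SHELL ⇒ MODEL bridge identifying
`ThetaModel.Theta`/`TorusData.ϑc` with these lifts/periods (referee 2 G-R2-11).  So this file reduces residual (1) of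
`pv08/N19` to those two items; it asserts nothing new (no PRINT input beyond N17's).
-/

set_option autoImplicit false

open MeasureTheory

namespace HodgeCM.PerL34.Seesaw.ThetaSeesawData

variable (D : ThetaSeesawData)

/-- PerL l. 247: "`u₁∧u₂` is the scalar function `u₁¹u₂² − u₁²u₂¹`" — the wedge of two one-forms given by their
component pairs `(u₁¹,u₁²)`, `(u₂¹,u₂²)` of scalar functions on `[G_U]` (here: on `G = G_U(𝔸)`). -/
def wedgeScalar (u₁₁ u₁₂ u₂₁ u₂₂ : D.G → ℂ) (g : D.G) : ℂ := u₁₁ g * u₂₂ g - u₁₂ g * u₂₁ g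

/-- (Ported verbatim from the HodgeCMPerL package; no docstring in the source.) -/
theorem wedgeScalar_apply (u₁₁ u₁₂ u₂₁ u₂₂ : D.G → ℂ) (g : D.G) :
    D.wedgeScalar u₁₁ u₁₂ u₂₁ u₂₂ g = u₁₁ g * u₂₂ g - u₁₂ g * u₂₁ g := rfl

/-- The wedge is alternating in the pair of forms. -/
theorem wedgeScalar_swap (u₁₁ u₁₂ u₂₁ u₂₂ : D.G → ℂ) (g : D.G) :
    D.wedgeScalar u₂₁ u₂₂ u₁₁ u₁₂ g = - D.wedgeScalar u₁₁ u₁₂ u₂₁ u₂₂ g := by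
  simp only [wedgeScalar]; ring

/-- (Ported verbatim from the HodgeCMPerL package; no docstring in the source.) -/
theorem wedgeScalar_self (u₁ u₂ : D.G → ℂ) (g : D.G) : D.wedgeScalar u₁ u₂ u₁ u₂ g = 0 := by
  simp only [wedgeScalar]; ring

/-! ### Summability of the theta series of a pure tensor (from N17's hypotheses) -/

/-- The theta series of `ω(g,t)(φ₁⊗φ₂)` converges absolutely: its terms are the products
`(ω₁φ₁)(x₁)(ω₂φ₂)(x₂)` of two absolutely summable families. -/
theorem summable_norm_ev_tmul (hE : D.EvalTmul) (hR : D.RestrictTmul) (hS₁ : D.AbsSummable₁)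
    (hS₂ : D.AbsSummable₂) (φ₁ : D.S₁) (φ₂ : D.S₂) (g : D.G) (t : D.A₁ × D.A₂) :
    Summable fun z => ‖D.ev (D.ωW g t (D.tmul φ₁ φ₂)) z‖ := by
  obtain ⟨u₁, u₂⟩ := t
  unfold EvalTmul at hE
  unfold RestrictTmul at hR
  simp only [hR, hE, norm_mul]
  exact summable_mul_of_summable_norm (f := fun x => ‖D.ev₁ (D.ω₁ g u₁ φ₁) x‖)
    (g := fun x => ‖D.ev₂ (D.ω₂ g u₂ φ₂) x‖) (by simpa using hS₁ _) (by simpa using hS₂ _)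

/-- (Ported verbatim from the HodgeCMPerL package; no docstring in the source.) -/
theorem summable_ev_tmul (hE : D.EvalTmul) (hR : D.RestrictTmul) (hS₁ : D.AbsSummable₁)
    (hS₂ : D.AbsSummable₂) (φ₁ : D.S₁) (φ₂ : D.S₂) (g : D.G) (t : D.A₁ × D.A₂) :
    Summable fun z => D.ev (D.ωW g t (D.tmul φ₁ φ₂)) z :=
  (D.summable_norm_ev_tmul hE hR hS₁ hS₂ φ₁ φ₂ g t).of_norm

/-! ### Additivity of `Φ ↦ θ_Φ` and `Φ ↦ ϑ_{T,χ₁₂}(Φ)` -/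

section Additive

variable [AddCommGroup D.S]

/-- STRUCTURAL HYPOTHESIS (the model: `ω_{W,μ_W}(g,t)` is a linear operator on the vector space
`𝒮((V₃⊗W)(𝔸))`, PerL l. 261 "the Weil representation … on `𝒮((V₃⊗W)(𝔸))`"): it respects differences. -/
def OmegaSub : Prop := ∀ (g : D.G) (t : D.A₁ × D.A₂) (Φ Φ' : D.S), D.ωW g t (Φ - Φ') = D.ωW g t Φ - D.ωW g t Φ'

/-- STRUCTURAL HYPOTHESIS (the model: evaluation of a function at a point is linear). -/
def EvSub : Prop := ∀ (Φ Φ' : D.S) (z : D.X₁ × D.X₂), D.ev (Φ - Φ') z = D.ev Φ z - D.ev Φ' z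

/-- `θ_{Φ−Φ′} = θ_Φ − θ_{Φ′}` for absolutely convergent theta series. -/
theorem thetaKernel_sub (hΩ : D.OmegaSub) (hV : D.EvSub) {Φ Φ' : D.S} {g : D.G} {t : D.A₁ × D.A₂}
    (hΦ : Summable fun z => D.ev (D.ωW g t Φ) z) (hΦ' : Summable fun z => D.ev (D.ωW g t Φ') z) :
    D.thetaKernel (Φ - Φ') g t = D.thetaKernel Φ g t - D.thetaKernel Φ' g t := by
  unfold OmegaSub at hΩ
  unfold EvSub at hV
  simp only [thetaKernel, hΩ, hV]
  exact hΦ.tsum_sub hΦ'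

/-- The theta kernel of PerL's test vector `Φ′ = φ¹₁⊗φ²₂ − φ²₁⊗φ¹₂` (l. 374), by N17's `thetaKernel_tmul`:
`θ_{Φ′}(g,(u₁,u₂)) = θ_{φ¹₁}(g,u₁)θ_{φ²₂}(g,u₂) − θ_{φ²₁}(g,u₁)θ_{φ¹₂}(g,u₂)`. -/
theorem thetaKernel_wedge (hΩ : D.OmegaSub) (hV : D.EvSub) (hE : D.EvalTmul) (hR : D.RestrictTmul)
    (hS₁ : D.AbsSummable₁) (hS₂ : D.AbsSummable₂) (φ₁₁ φ₁₂ : D.S₁) (φ₂₁ φ₂₂ : D.S₂) (g : D.G)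
    (t : D.A₁ × D.A₂) :
    D.thetaKernel (D.tmul φ₁₁ φ₂₂ - D.tmul φ₁₂ φ₂₁) g t
      = D.thetaKernel₁ φ₁₁ g t.1 * D.thetaKernel₂ φ₂₂ g t.2
        - D.thetaKernel₁ φ₁₂ g t.1 * D.thetaKernel₂ φ₂₁ g t.2 := by
  rw [D.thetaKernel_sub hΩ hV (D.summable_ev_tmul hE hR hS₁ hS₂ _ _ _ _)
    (D.summable_ev_tmul hE hR hS₁ hS₂ _ _ _ _), D.thetaKernel_tmul hE hR hS₁ hS₂,
    D.thetaKernel_tmul hE hR hS₁ hS₂]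

variable [MeasurableSpace D.A₁] [MeasurableSpace D.A₂] (ν₁ : Measure D.A₁) (ν₂ : Measure D.A₂)

/-- `ϑ_{T,χ₁₂}(Φ − Φ′) = ϑ_{T,χ₁₂}(Φ) − ϑ_{T,χ₁₂}(Φ′)` when the two integrands are integrable on `[T]` and the
theta series converge absolutely. -/
theorem thetaPeriod_sub (hΩ : D.OmegaSub) (hV : D.EvSub) (χ₁ : D.A₁ → ℂ) (χ₂ : D.A₂ → ℂ) {Φ Φ' : D.S}
    {g : D.G} (hΦ : ∀ t, Summable fun z => D.ev (D.ωW g t Φ) z)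
    (hΦ' : ∀ t, Summable fun z => D.ev (D.ωW g t Φ') z)
    (hI : Integrable (fun t => D.thetaKernel Φ g t * (χ₁ t.1 * χ₂ t.2)) (ν₁.prod ν₂))
    (hI' : Integrable (fun t => D.thetaKernel Φ' g t * (χ₁ t.1 * χ₂ t.2)) (ν₁.prod ν₂)) :
    D.thetaPeriod ν₁ ν₂ χ₁ χ₂ (Φ - Φ') g
      = D.thetaPeriod ν₁ ν₂ χ₁ χ₂ Φ g - D.thetaPeriod ν₁ ν₂ χ₁ χ₂ Φ' g := by
  simp only [thetaPeriod]
  rw [← integral_sub hI hI']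
  congr 1
  funext t
  rw [D.thetaKernel_sub hΩ hV (hΦ t) (hΦ' t)]
  ring

/-- **The seesaw-generator identity, first equality of PerL ll. 374–375 (KERNEL-PROVED at the level of the
theta data):** with `u^i_j := θ(φ^i_j, χ′_j)` (`i = 1,2` the two components of the one-form `u_j`, `j = 1,2`),
`u₁∧u₂ = u₁¹u₂² − u₁²u₂¹ = ϑ_{T,χ₁₂}(Φ′)` for `Φ′ = φ¹₁⊗φ²₂ − φ²₁⊗φ¹₂`, as functions of `g ∈ G_U(𝔸)`.
Inputs: N17's hypotheses (`EvalTmul`, `RestrictTmul`, `AbsSummable₁/₂`), the structural `OmegaSub`/`EvSub`, and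
integrability on the compact `[U(W_j)]` of `u ↦ θ_{φ^i_j}(g,u)χ′_j(u)` (PerL l. 335). -/
theorem genIdentity_core [SFinite ν₁] [SFinite ν₂] (hΩ : D.OmegaSub) (hV : D.EvSub) (hE : D.EvalTmul)
    (hR : D.RestrictTmul) (hS₁ : D.AbsSummable₁) (hS₂ : D.AbsSummable₂) (χ₁ : D.A₁ → ℂ) (χ₂ : D.A₂ → ℂ)
    (φ₁₁ φ₁₂ : D.S₁) (φ₂₁ φ₂₂ : D.S₂) (g : D.G)
    (hI₁₁ : Integrable (fun u => D.thetaKernel₁ φ₁₁ g u * χ₁ u) ν₁)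
    (hI₁₂ : Integrable (fun u => D.thetaKernel₁ φ₁₂ g u * χ₁ u) ν₁)
    (hI₂₁ : Integrable (fun u => D.thetaKernel₂ φ₂₁ g u * χ₂ u) ν₂)
    (hI₂₂ : Integrable (fun u => D.thetaKernel₂ φ₂₂ g u * χ₂ u) ν₂) :
    D.wedgeScalar (D.thetaLift₁ ν₁ χ₁ φ₁₁) (D.thetaLift₁ ν₁ χ₁ φ₁₂) (D.thetaLift₂ ν₂ χ₂ φ₂₁)
        (D.thetaLift₂ ν₂ χ₂ φ₂₂) g
      = D.thetaPeriod ν₁ ν₂ χ₁ χ₂ (D.tmul φ₁₁ φ₂₂ - D.tmul φ₁₂ φ₂₁) g := by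
  -- integrability of the two pure-tensor integrands on `[T] = [U(W₁)] × [U(W₂)]`
  have hint : ∀ (φ₁ : D.S₁) (φ₂ : D.S₂), Integrable (fun u => D.thetaKernel₁ φ₁ g u * χ₁ u) ν₁ →
      Integrable (fun u => D.thetaKernel₂ φ₂ g u * χ₂ u) ν₂ →
      Integrable (fun t => D.thetaKernel (D.tmul φ₁ φ₂) g t * (χ₁ t.1 * χ₂ t.2)) (ν₁.prod ν₂) := by
    intro φ₁ φ₂ h₁ h₂
    have h := h₁.mul_prod h₂
    refine h.congr (Filter.Eventually.of_forall fun t => ?_)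
    simp only [D.thetaKernel_tmul hE hR hS₁ hS₂]
    ring
  rw [D.thetaPeriod_sub ν₁ ν₂ hΩ hV χ₁ χ₂ (fun t => D.summable_ev_tmul hE hR hS₁ hS₂ _ _ _ _)
    (fun t => D.summable_ev_tmul hE hR hS₁ hS₂ _ _ _ _) (hint _ _ hI₁₁ hI₂₂) (hint _ _ hI₁₂ hI₂₁),
    ← D.eq_seesaw ν₁ ν₂ hE hR hS₁ hS₂, ← D.eq_seesaw ν₁ ν₂ hE hR hS₁ hS₂, wedgeScalar]

/-- The same identity with PerL's lift notation on the left spelled out as integrals. -/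
theorem genIdentity_core' [SFinite ν₁] [SFinite ν₂] (hΩ : D.OmegaSub) (hV : D.EvSub) (hE : D.EvalTmul)
    (hR : D.RestrictTmul) (hS₁ : D.AbsSummable₁) (hS₂ : D.AbsSummable₂) (χ₁ : D.A₁ → ℂ) (χ₂ : D.A₂ → ℂ)
    (φ₁₁ φ₁₂ : D.S₁) (φ₂₁ φ₂₂ : D.S₂) (g : D.G)
    (hI₁₁ : Integrable (fun u => D.thetaKernel₁ φ₁₁ g u * χ₁ u) ν₁)
    (hI₁₂ : Integrable (fun u => D.thetaKernel₁ φ₁₂ g u * χ₁ u) ν₁)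
    (hI₂₁ : Integrable (fun u => D.thetaKernel₂ φ₂₁ g u * χ₂ u) ν₂)
    (hI₂₂ : Integrable (fun u => D.thetaKernel₂ φ₂₂ g u * χ₂ u) ν₂) :
    (∫ u, D.thetaKernel₁ φ₁₁ g u * χ₁ u ∂ν₁) * (∫ u, D.thetaKernel₂ φ₂₂ g u * χ₂ u ∂ν₂)
      - (∫ u, D.thetaKernel₁ φ₁₂ g u * χ₁ u ∂ν₁) * (∫ u, D.thetaKernel₂ φ₂₁ g u * χ₂ u ∂ν₂)
      = ∫ t, D.thetaKernel (D.tmul φ₁₁ φ₂₂ - D.tmul φ₁₂ φ₂₁) g t * (χ₁ t.1 * χ₂ t.2) ∂(ν₁.prod ν₂) :=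
  D.genIdentity_core ν₁ ν₂ hΩ hV hE hR hS₁ hS₂ χ₁ χ₂ φ₁₁ φ₁₂ φ₂₁ φ₂₂ g hI₁₁ hI₁₂ hI₂₁ hI₂₂

end Additive

end HodgeCM.PerL34.Seesaw.ThetaSeesawData
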